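import Literature.MathematicalPhysics.QuantumFieldTheory.Balaban1983to89.Beta.RemainderLocalityHolo

/-!
# `Beta.RemainderDecay190HoloChain` — the remainder chains over the HOLOMORPHIC-currency torus leaf lists and their
# k-UNIFORM ENDs `|β¹_{k+1}| ≤ ε₁ · K_rem,L` (SAME closed coefficient as the analytic-currency chains)

Cell pub-balaban, β-function sub-cell, BINDER row D4 (unit `b2b-balaban-beta-an4` gen 49, row D4 OWNER).  Sibling of
`Beta.RemainderLimitTorusHolo` / `Beta.RemainderLocalityHolo` (see their docstrings for the WHY: design point M1′ of
`HOME/b2b-balaban-beta-an4/D4-CRUX-SOCKETS.md` — the producers of one-step functionals deliver `DifferentiableOn ℂ`,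
not `AnalyticOnNhd ℂ`, and Mathlib has no Banach-domain upgrade).

WHAT IS PROVED (0 sorry; [folklore] bookkeeping + the printed shapes):
* §2 `ChainTLocH` (twin of `RemainderLimitTorus.ChainTLoc` over `PolLeavesTLocH`) and
  **`ChainTLocH.abs_beta1_le : RemainderConst S γ (ε₁ · remCoeffL d M c α₂ B₃)`**; the one-sided form; the two
  RULING-(R10) consumers (`…_of_telescope_chainTLocH`, through `DriftRemainder.…_of_telescope_remainderConst`).
* §3 `ChainTLocH.ofAnalytic` (with `RemainderLocalityHolo`'s `PolLeavesTLocH.ofAnalytic`) + a consistency `example`.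
* §4 `ChainTFacH` (twin of `RemainderLocality.ChainTFac`), `toChainTLocH`, `abs_beta1_le`, `neg_le_beta1`.
* §5 **`ChainTFac190H`** (twin of `RemainderDecay190.ChainTFac190` — THE ROW-D4 SOCKET IN HOLOMORPHIC CURRENCY),
  `toChainTFacH`, **`ChainTFac190H.abs_beta1_le : RemainderConst S γ (ε₁ · remCoeffL d M c α₂ q.B₃)`** — the SAME END
  and coefficient as `ChainTFac190.abs_beta1_le`; `neg_le_beta1`; the RULING-(R10) consumers
  `betaPartialSumsLowerH_of_telescope_chainTFac190H`, `endpointExistence_of_telescope_chainTFac190H`;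
  `ChainTFac190H.ofAnalytic` (every analytic-currency inhabitant is a holomorphic-currency one) + a consistency `example`.
HONEST FRAMING: a re-threading of the REDUCTION; nothing of Bałaban's asserted; (D4) NOT discharged (instance 0/1 in
either currency); NOT BetaPertH, NOT continuum, NOT Clay.  HONEST DEPENDENCY: continuum YM on T⁴ ⇐ BetaPertH ∧ nine
spine estimates (0/9 proved); BetaPertH ⇐ (D1) ∧ (D4) ∧ CAP+tail; G-an2-4 gates asym, D1 and NE2/3/4.
-/

namespace Literature.MathematicalPhysics.QuantumFieldTheory.Balaban1983to89.Beta.RemainderDecay190HoloChain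

open Literature.MathematicalPhysics.QuantumFieldTheory.Balaban1983to89
open FlowStep DagBinding FlowStepRuns
open Literature.MathematicalPhysics.QuantumFieldTheory.Balaban1983to89.B13ScaleTransfer (Pt)
open Literature.MathematicalPhysics.QuantumFieldTheory.Balaban1983to89.Beta.RemainderChain
open Literature.MathematicalPhysics.QuantumFieldTheory.Balaban1983to89.Beta.RemainderChainLattice
  (CondsL SignsL remCoeffL polConstL deltaL deltaL_pos eps1_mul_remCoeffL)
open Literature.MathematicalPhysics.QuantumFieldTheory.Balaban1983to89.Beta.RemainderLimitTorus
open Literature.MathematicalPhysics.QuantumFieldTheory.Balaban1983to89.Beta.RemainderLimitTorusHolo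
open Literature.MathematicalPhysics.QuantumFieldTheory.Balaban1983to89.Beta.RemainderLocality (PolLeavesTFac ChainTFac)
open Literature.MathematicalPhysics.QuantumFieldTheory.Balaban1983to89.Beta.RemainderLocalityHolo
open Literature.MathematicalPhysics.QuantumFieldTheory.Balaban1983to89.Beta.RemainderDecay190
  (Consts190 PolLeavesTFac190 ChainTFac190)
open Literature.MathematicalPhysics.QuantumFieldTheory.Balaban1983to89.Beta.DriftRemainder
  (betaPartialSumsLowerH_of_telescope_remainderConst endpointExistence_of_telescope_remainderConst)
open Metric Filter Topology

noncomputable section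

variable {d : ℕ}

/-! ## §2 The chain with termwise locality in holomorphic currency and the k-UNIFORM bound — SAME coefficient -/

section Chain

variable {M : ℕ} [NeZero M]

/-- **THE REMAINDER CHAIN ON THE PERIODIC CARRIER WITH TERMWISE LOCALITY, HOLOMORPHIC CURRENCY** (twin of
`RemainderLimitTorus.ChainTLoc` with `PolLeavesTLocH` leaves).  A HYPOTHESIS structure.
[cite: Balaban1987RG1, (1.20)-(1.22) p.264; Balaban1988RG2Cluster, (2.38) p.20] -/
structure ChainTLocH (d M : ℕ) [NeZero M] (μ ν : Fin d) {β : HBeta} (S : B12Beta.OneLoopSplit β) (γ : ℝ)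
    (c : B13.Consts) (ℓ α₂ B₃ : ℝ) where
  A1 : (k : ℕ) → (Fin (k + 1) → ℝ) → LDom d → Pt d → ℝ
  beta1_eq : ∀ k p, p ∈ B12Beta.HistBox γ k →
    S.β1 k p = B12Beta.secondMoment (fun _ _ => limKernel (A1 k p)) μ ν
  leaves : ∀ k p, p ∈ B12Beta.HistBox γ k → PolLeavesTLocH d M (A1 k p) c ℓ α₂ B₃

variable {μ ν : Fin d} {β : HBeta} {S : B12Beta.OneLoopSplit β} {γ : ℝ} {c : B13.Consts} {ℓ α₂ B₃ : ℝ}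

/-- **THE k-UNIFORM REMAINDER BOUND, HOLOMORPHIC CURRENCY, coefficient FULLY VALUED AND IDENTICAL TO
`ChainTLoc.abs_beta1_le`'s**: `|β¹_{k+1}(g_0,…,g_k)| ≤ ε₁ · K_rem,L` for EVERY scale k and EVERY history in `]0,γ]^{k+1}`,
`K_rem,L = RemainderChainLattice.remCoeffL d M c α₂ B₃`.  O(ε₁), not O(g_k), not O(γ²).
[cite: Balaban1988RG2Cluster, (2.38) p.20; Balaban1987RG1, (5.10) p.293 and (1.22) p.264] -/
theorem ChainTLocH.abs_beta1_le (R : ChainTLocH d M μ ν S γ c ℓ α₂ B₃) (hC : CondsL d c ℓ) (h22 : c.R22gen ℓ)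
    (hs : SignsL c α₂ B₃) (hd : 0 < d) : RemainderConst S γ (c.ε₁ * remCoeffL d M c α₂ B₃) := by
  intro k p hp
  have hδ₁ : 0 < deltaL d M c := deltaL_pos hC hs.δ₀_pos hd (Nat.pos_of_neZero M)
  have hdec := (R.leaves k p hp).decay510 hC h22 hs hd
  rw [R.beta1_eq k p hp, eps1_mul_remCoeffL]
  exact abs_secondMoment_le_linear hδ₁ hdec

/-- The one-sided form `−ε₁K_rem,L ≤ β¹_{k+1}` on the boxes (the binder shape of [I] Thm 2's lower half, RULING (R10)'s
remainder slot). [cite: Balaban1987RG1, Thm 2 p.259 and (1.22) p.264] -/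
theorem ChainTLocH.neg_le_beta1 (R : ChainTLocH d M μ ν S γ c ℓ α₂ B₃) (hC : CondsL d c ℓ) (h22 : c.R22gen ℓ)
    (hs : SignsL c α₂ B₃) (hd : 0 < d) :
    ∀ k (p : Fin (k + 1) → ℝ), p ∈ B12Beta.HistBox γ k → -(c.ε₁ * remCoeffL d M c α₂ B₃) ≤ S.β1 k p :=
  fun k p hp => (abs_le.mp (R.abs_beta1_le hC h22 hs hd k p hp)).1

/-- **`BetaPartialSumsLowerH` from telescoping + the holomorphic-currency chain**
(`DriftRemainder.betaPartialSumsLowerH_of_telescope_remainderConst` ∘ `abs_beta1_le`).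
[cite: Balaban1987RG1, Thm 2 p.259 (first sentence); Balaban1988RG2Cluster, (2.38) p.20] -/
theorem betaPartialSumsLowerH_of_telescope_chainTLocH {γ₀ b A : ℝ} {B : ℕ → ℝ} {L : ℕ}
    (R : ChainTLocH d M μ ν S γ₀ c ℓ α₂ B₃) (hC : CondsL d c ℓ) (h22 : c.R22gen ℓ) (hs : SignsL c α₂ B₃)
    (hd : 0 < d) (hL : 2 ≤ L) (hA : 0 ≤ A) (hTel : ∀ k : ℕ, ∑ j ∈ Finset.range k, S.β0 j = B (L ^ k))
    (hB : ∀ n : ℕ, 2 ≤ n → |B n - b * Real.log n| ≤ A) (hε₁ : c.ε₁ * remCoeffL d M c α₂ B₃ ≤ b * Real.log L) :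
    BetaPartialSumsLowerH (2 * A) γ₀ β :=
  betaPartialSumsLowerH_of_telescope_remainderConst S hL hA hTel hB (R.abs_beta1_le hC h22 hs hd) hε₁

/-- **ENDPOINT EXISTENCE from telescoping + the holomorphic-currency chain** ([I] Thm 2 first sentence for
forward-generated constructions; `DriftRemainder.endpointExistence_of_telescope_remainderConst` ∘ `abs_beta1_le`).
[cite: Balaban1987RG1, Thm 2 p.259 (first sentence); Balaban1988RG2Cluster, (2.38) p.20] -/
theorem endpointExistence_of_telescope_chainTLocH {C : B12.Construction} (hgen : ForwardGenerated C β)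
    {γ₀ b A β' : ℝ} {B : ℕ → ℝ} {L : ℕ} (R : ChainTLocH d M μ ν S γ₀ c ℓ α₂ B₃) (hC : CondsL d c ℓ)
    (h22 : c.R22gen ℓ) (hs : SignsL c α₂ B₃) (hd : 0 < d) (hγ₀ : 0 < γ₀) (hL : 2 ≤ L) (hA : 0 ≤ A)
    (hTel : ∀ k : ℕ, ∑ j ∈ Finset.range k, S.β0 j = B (L ^ k))
    (hB : ∀ n : ℕ, 2 ≤ n → |B n - b * Real.log n| ≤ A) (hε₁ : c.ε₁ * remCoeffL d M c α₂ B₃ ≤ b * Real.log L)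
    (hβ' : 0 ≤ β') (hcont : BetaContH γ₀ β) (hup : BetaUpperH β' γ₀ β) : EndpointExistence C :=
  endpointExistence_of_telescope_remainderConst hgen S hγ₀ hL hA hTel hB (R.abs_beta1_le hC h22 hs hd) hε₁ hβ' hcont
    hup

end Chain

/-! ## §3 The analytic-currency data ARE holomorphic-currency data -/

section OfAnalytic

variable {M : ℕ} [NeZero M] {a : LDom d → Pt d → ℝ} {c : B13.Consts} {ℓ α₂ B₃ : ℝ}

variable {μ ν : Fin d} {β : HBeta} {S : B12Beta.OneLoopSplit β} {γ : ℝ}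

/-- An analytic-currency chain IS a holomorphic-currency chain. [folklore] -/
def ChainTLocH.ofAnalytic (R : ChainTLoc d M μ ν S γ c ℓ α₂ B₃) : ChainTLocH d M μ ν S γ c ℓ α₂ B₃ where
  A1 := R.A1
  beta1_eq := R.beta1_eq
  leaves := fun k p hp => PolLeavesTLocH.ofAnalytic (R.leaves k p hp)

/-- Consistency: through `ofAnalytic` the new END reproduces the old END's conclusion verbatim. [folklore] -/
example (R : ChainTLoc d M μ ν S γ c ℓ α₂ B₃) (hC : CondsL d c ℓ)
    (h22 : c.R22gen ℓ) (hs : SignsL c α₂ B₃) (hd : 0 < d) :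
    RemainderConst S γ (c.ε₁ * remCoeffL d M c α₂ B₃) :=
  (ChainTLocH.ofAnalytic R).abs_beta1_le hC h22 hs hd

end OfAnalytic

/-! ## §4 The chain with (1.7)-factorization in holomorphic currency -/

section ChainFac

variable {M : ℕ} [NeZero M]

/-- **THE REMAINDER CHAIN ON THE PERIODIC CARRIER WITH (1.7)-FACTORIZATION, HOLOMORPHIC CURRENCY** (twin of
`RemainderLocality.ChainTFac` with `PolLeavesTFacH` leaves).  A HYPOTHESIS structure.
[cite: Balaban1987RG1, (1.20)-(1.22) p.264 and (1.7) p.261; Balaban1988RG2Cluster, (2.38) p.20] -/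
structure ChainTFacH (d M : ℕ) [NeZero M] (μ ν : Fin d) {β : HBeta} (S : B12Beta.OneLoopSplit β) (γ : ℝ)
    (c : B13.Consts) (ℓ α₂ B₃ : ℝ) where
  A1 : (k : ℕ) → (Fin (k + 1) → ℝ) → LDom d → Pt d → ℝ
  beta1_eq : ∀ k p, p ∈ B12Beta.HistBox γ k →
    S.β1 k p = B12Beta.secondMoment (fun _ _ => limKernel (A1 k p)) μ ν
  leaves : ∀ k p, p ∈ B12Beta.HistBox γ k → PolLeavesTFacH d M (A1 k p) c ℓ α₂ B₃

variable {μ ν : Fin d} {β : HBeta} {S : B12Beta.OneLoopSplit β} {γ : ℝ} {c : B13.Consts} {ℓ α₂ B₃ : ℝ}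

/-- A holomorphic-currency chain with (1.7)-factorization IS one with termwise locality. [folklore] -/
def ChainTFacH.toChainTLocH (R : ChainTFacH d M μ ν S γ c ℓ α₂ B₃) (hα₂ : 0 < α₂) :
    ChainTLocH d M μ ν S γ c ℓ α₂ B₃ where
  A1 := R.A1
  beta1_eq := R.beta1_eq
  leaves := fun k p hp => (R.leaves k p hp).toPolLeavesTLocH hα₂

/-- **THE k-UNIFORM REMAINDER BOUND WITH (1.7)-FACTORIZATION, HOLOMORPHIC CURRENCY** — SAME coefficient
`ε₁ · remCoeffL d M c α₂ B₃` as `RemainderLocality.ChainTFac.abs_beta1_le`.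
[cite: Balaban1988RG2Cluster, (2.38) p.20; Balaban1987RG1, (5.10) p.293, (1.22) p.264 and (1.7) p.261] -/
theorem ChainTFacH.abs_beta1_le (R : ChainTFacH d M μ ν S γ c ℓ α₂ B₃) (hC : CondsL d c ℓ) (h22 : c.R22gen ℓ)
    (hs : SignsL c α₂ B₃) (hd : 0 < d) : RemainderConst S γ (c.ε₁ * remCoeffL d M c α₂ B₃) :=
  (R.toChainTLocH hs.α₂_pos).abs_beta1_le hC h22 hs hd

/-- The one-sided form `−ε₁K_rem,L ≤ β¹_{k+1}` on the boxes (the binder shape of [I] Thm 2's lower half).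
[cite: Balaban1987RG1, Thm 2 p.259 and (1.22) p.264] -/
theorem ChainTFacH.neg_le_beta1 (R : ChainTFacH d M μ ν S γ c ℓ α₂ B₃) (hC : CondsL d c ℓ) (h22 : c.R22gen ℓ)
    (hs : SignsL c α₂ B₃) (hd : 0 < d) :
    ∀ k (p : Fin (k + 1) → ℝ), p ∈ B12Beta.HistBox γ k → -(c.ε₁ * remCoeffL d M c α₂ B₃) ≤ S.β1 k p :=
  fun k p hp => (abs_le.mp (R.abs_beta1_le hC h22 hs hd k p hp)).1

/-- `RemainderLocality.ChainTFac` ⟹ `ChainTFacH`. [folklore] -/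
def ChainTFacH.ofAnalytic (R : ChainTFac d M μ ν S γ c ℓ α₂ B₃) : ChainTFacH d M μ ν S γ c ℓ α₂ B₃ where
  A1 := R.A1
  beta1_eq := R.beta1_eq
  leaves := fun k p hp => PolLeavesTFacH.ofAnalytic (R.leaves k p hp)

end ChainFac

/-! ## §5 The row-D4 socket in holomorphic currency: the chain with the (190)-side data -/

section Chain190

variable {M : ℕ} [NeZero M]

/-- **THE REMAINDER CHAIN WITH (1.7)-FACTORIZATION AND THE (190)-SIDE DATA, HOLOMORPHIC CURRENCY** (twin of
`RemainderDecay190.ChainTFac190` with `PolLeavesTFac190H` leaves) — the row-D4 socket with its two analyticity leaves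
read as complex Fréchet differentiability.  A HYPOTHESIS structure.
[cite: Balaban1987RG1, (1.20)-(1.22) p.264, (1.7) p.261 and (4.4) p.281; Balaban1988RG2Cluster, (2.38) p.20; Balaban1985Variational, (190) p.308] -/
structure ChainTFac190H (d M : ℕ) [NeZero M] (μ ν : Fin d) {β : HBeta} (S : B12Beta.OneLoopSplit β) (γ : ℝ)
    (c : B13.Consts) (ℓ α₂ : ℝ) (q : Consts190) where
  A1 : (k : ℕ) → (Fin (k + 1) → ℝ) → LDom d → Pt d → ℝ
  beta1_eq : ∀ k p, p ∈ B12Beta.HistBox γ k →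
    S.β1 k p = B12Beta.secondMoment (fun _ _ => limKernel (A1 k p)) μ ν
  leaves : ∀ k p, p ∈ B12Beta.HistBox γ k → PolLeavesTFac190H d M (A1 k p) c ℓ α₂ q

variable {μ ν : Fin d} {β : HBeta} {S : B12Beta.OneLoopSplit β} {γ : ℝ} {c : B13.Consts} {ℓ α₂ : ℝ}
  {q : Consts190}

/-- A holomorphic-currency chain with the (190)-side data IS one with (1.7)-factorization at B₃ := Cκ̄_Bcm. [folklore] -/
def ChainTFac190H.toChainTFacH (R : ChainTFac190H d M μ ν S γ c ℓ α₂ q) (hq : q.Valid c.δ₀) :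
    ChainTFacH d M μ ν S γ c ℓ α₂ q.B₃ where
  A1 := R.A1
  beta1_eq := R.beta1_eq
  leaves := fun k p hp => (R.leaves k p hp).toPolLeavesTFacH hq

/-- **THE ROW-D4 END IN HOLOMORPHIC CURRENCY**: `|β¹_{k+1}(g_0,…,g_k)| ≤ ε₁ · K_rem,L(d, M, c, α₂, Cκ̄_Bcm)` for EVERY
scale and EVERY history in the box — the SAME conclusion and coefficient as `RemainderDecay190.ChainTFac190.abs_beta1_le`,
from leaves whose analyticity fields are `DifferentiableOn ℂ`. [cite: Balaban1988RG2Cluster, (2.38) p.20; Balaban1987RG1, (5.10) p.293, (1.22) p.264 and (1.7) p.261; Balaban1985Variational, (190) p.308] -/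
theorem ChainTFac190H.abs_beta1_le (R : ChainTFac190H d M μ ν S γ c ℓ α₂ q) (hC : CondsL d c ℓ)
    (h22 : c.R22gen ℓ) (hq : q.Valid c.δ₀) (hs : SignsL c α₂ q.B₃) (hd : 0 < d) :
    RemainderConst S γ (c.ε₁ * remCoeffL d M c α₂ q.B₃) :=
  (R.toChainTFacH hq).abs_beta1_le hC h22 hs hd

/-- The one-sided form `−ε₁K_rem,L ≤ β¹_{k+1}` on the boxes (the binder shape of [I] Thm 2's lower half).
[cite: Balaban1987RG1, Thm 2 p.259 and (1.22) p.264] -/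
theorem ChainTFac190H.neg_le_beta1 (R : ChainTFac190H d M μ ν S γ c ℓ α₂ q) (hC : CondsL d c ℓ)
    (h22 : c.R22gen ℓ) (hq : q.Valid c.δ₀) (hs : SignsL c α₂ q.B₃) (hd : 0 < d) :
    ∀ k (p : Fin (k + 1) → ℝ), p ∈ B12Beta.HistBox γ k → -(c.ε₁ * remCoeffL d M c α₂ q.B₃) ≤ S.β1 k p :=
  (R.toChainTFacH hq).neg_le_beta1 hC h22 hs hd

/-- **`BetaPartialSumsLowerH` from telescoping + the holomorphic-currency row-D4 chain**
(`DriftRemainder.betaPartialSumsLowerH_of_telescope_remainderConst` ∘ `abs_beta1_le`).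
[cite: Balaban1987RG1, Thm 2 p.259 (first sentence); Balaban1988RG2Cluster, (2.38) p.20; Balaban1985Variational, (190) p.308] -/
theorem betaPartialSumsLowerH_of_telescope_chainTFac190H {γ₀ b A : ℝ} {B : ℕ → ℝ} {L : ℕ}
    (R : ChainTFac190H d M μ ν S γ₀ c ℓ α₂ q) (hC : CondsL d c ℓ) (h22 : c.R22gen ℓ) (hq : q.Valid c.δ₀)
    (hs : SignsL c α₂ q.B₃) (hd : 0 < d) (hL : 2 ≤ L) (hA : 0 ≤ A)
    (hTel : ∀ k : ℕ, ∑ j ∈ Finset.range k, S.β0 j = B (L ^ k)) (hB : ∀ n : ℕ, 2 ≤ n → |B n - b * Real.log n| ≤ A)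
    (hε₁ : c.ε₁ * remCoeffL d M c α₂ q.B₃ ≤ b * Real.log L) : BetaPartialSumsLowerH (2 * A) γ₀ β :=
  betaPartialSumsLowerH_of_telescope_remainderConst S hL hA hTel hB (R.abs_beta1_le hC h22 hq hs hd) hε₁

/-- **ENDPOINT EXISTENCE from telescoping + the holomorphic-currency row-D4 chain**
(`DriftRemainder.endpointExistence_of_telescope_remainderConst` ∘ `abs_beta1_le`).
[cite: Balaban1987RG1, Thm 2 p.259 (first sentence); Balaban1988RG2Cluster, (2.38) p.20; Balaban1985Variational, (190) p.308] -/
theorem endpointExistence_of_telescope_chainTFac190H {C : B12.Construction} (hgen : ForwardGenerated C β)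
    {γ₀ b A β' : ℝ} {B : ℕ → ℝ} {L : ℕ} (R : ChainTFac190H d M μ ν S γ₀ c ℓ α₂ q) (hC : CondsL d c ℓ)
    (h22 : c.R22gen ℓ) (hq : q.Valid c.δ₀) (hs : SignsL c α₂ q.B₃) (hd : 0 < d) (hγ₀ : 0 < γ₀) (hL : 2 ≤ L)
    (hA : 0 ≤ A) (hTel : ∀ k : ℕ, ∑ j ∈ Finset.range k, S.β0 j = B (L ^ k))
    (hB : ∀ n : ℕ, 2 ≤ n → |B n - b * Real.log n| ≤ A) (hε₁ : c.ε₁ * remCoeffL d M c α₂ q.B₃ ≤ b * Real.log L)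
    (hβ' : 0 ≤ β') (hcont : BetaContH γ₀ β) (hup : BetaUpperH β' γ₀ β) : EndpointExistence C :=
  endpointExistence_of_telescope_remainderConst hgen S hγ₀ hL hA hTel hB (R.abs_beta1_le hC h22 hq hs hd) hε₁ hβ'
    hcont hup

/-- `RemainderDecay190.ChainTFac190` ⟹ `ChainTFac190H`: every analytic-currency inhabitant of the row-D4 socket is a
holomorphic-currency one. [folklore] -/
def ChainTFac190H.ofAnalytic (R : ChainTFac190 d M μ ν S γ c ℓ α₂ q) : ChainTFac190H d M μ ν S γ c ℓ α₂ q where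
  A1 := R.A1
  beta1_eq := R.beta1_eq
  leaves := fun k p hp => PolLeavesTFac190H.ofAnalytic (R.leaves k p hp)

/-- Consistency: through `ofAnalytic` the holomorphic-currency END reproduces `ChainTFac190.abs_beta1_le` verbatim
(an `example`, no new declaration). -/
example (R : ChainTFac190 d M μ ν S γ c ℓ α₂ q) (hC : CondsL d c ℓ)
    (h22 : c.R22gen ℓ) (hq : q.Valid c.δ₀) (hs : SignsL c α₂ q.B₃) (hd : 0 < d) :
    RemainderConst S γ (c.ε₁ * remCoeffL d M c α₂ q.B₃) :=
  (ChainTFac190H.ofAnalytic R).abs_beta1_le hC h22 hq hs hd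

end Chain190

end

end Literature.MathematicalPhysics.QuantumFieldTheory.Balaban1983to89.Beta.RemainderDecay190HoloChain
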